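import Summits.QuantumFields.YangMills.Theorems.FluctuationComparisonRegPrIntLS1aAlphaPhiMTowerBG
import Summits.QuantumFields.YangMills.Theorems.FluctuationComparisonRegPrIntLS1aOneStepLetterOfTransportBound
import HarnessLib

/-!
# S1a · THE ᵀ-EDITION OF THE (m)-DOOR OF RECORD FOR THE LINE's TOWER (✓p831345 → per-height TRANSPORT letters): the (α)-package + the five letters at `(K, K−j)`
# + the supplier's (E)-domains∕targets + ONE TRANSPORT LETTER PER HEIGHT `i ∈ [j, Ts)` ⟹ the letter `Φ_m` OF THE CUT DENSITY at every height of every invariantly and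
# measurably cut tower — the binder `hdomBG_j` of ✓p831345 DISCHARGED BY NAME through ✓p832521 ∘ ✓p832934

Cell `ym3-torus` (YM ladder rung R3 = continuum `SU(2)` Yang–Mills on the three-torus — a RUNG: NOT d = 4, NOT infinite volume, NOT a mass gap, NOT Clay).
Width seat «width 8» `ym3-torus-px8` (gen 26), FREE px helper on crux `stmt-QuantumFields-20520`, count-neutral, DEFINITION-FREE, default heartbeats.  FILE 4 of the seat.

WHY.  ✓p831345 `…S1aAlphaPhiMTowerBG.exists_admissible_schedule_phiM_tower_bg` is the (m)-door of record of the (m)_E node (UV3-NODE §69.18): (α)-package + five letters +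
the cut-height letter `hdomBG_j` ⟹ `Φ_m` of the cut density, one admissible schedule, every height.  This seat's ✓p832521 ∘ ✓p832934 reduce `hdomBG_j` BY KERNEL to ONE
TRANSPORT LETTER PER HEIGHT on print's renormalised densities (UV3-NODE §69.19 (2)), with the exponent budget `Δ_j := (c∕(1−q))·q^j` computed from `η_i ≤ c·q^i`
(✓`sum_Ico_le_geom`) and kept admissible by ✓`admissible_add_slack`.  THIS FILE is the composed door: the SAME statement as ✓p831345 with (i) the budget arguments
`(Δ, S₁, q₁, hΔ0, hΔ)` replaced by the per-step sizes `(η, c, q, hq0, hq1, hc, hη)`; (ii) one more tower-scope hypothesis `∀ j, Measurable (χ j)` (the line's `sfCut` has it: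
`RunPairOrgan.measurable_sfCut`); (iii) the binder `hdomBG_j` REPLACED by: the supplier's domains `Dm i` and targets `Tg i` (measurable, `Tg i ⊆ Dm i`, `Dm j` open, `χ_i = 1` on
`Tg i` for `j < i ≤ Ts`), the inclusion «(E)-good data of height `j` ⊆ Dm j» (read through `fieldShift`), and the TRANSPORT LETTERS
«`T_i(ρ_{K−(i+1)}) ≤ e^{η_i}·T_i(1_{Tg (i+1)}·ρ_{K−(i+1)})` for `dU_i`-a.e. `V ∈ Dm i`», `j ≤ i < Ts` (`T_i` = lit `kernelTransport dU_{i+1} dU_i (descend F ℰp i)`,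
`ρ_{K−(i+1)}` = lit `heightDensity F γ _ univ`).  Everything else — conclusion included — is ✓p831345's text byte for byte.

WHAT.  ★★★ `exists_admissible_schedule_phiM_tower_transport` (0 `def`, 0 `sorry`; proof = ✓p831345 at `Δ_j := (c∕(1−q))·q^j` ∘ ✓`hdomBG_of_transportLetters_heightDensity`).
★p1's DISPLAYED BINDER LIST of the (m)_E door after this file: {(α)-inhabitant `AlphaInputsT3ACFullTriv` (UNINHABITED) · `hlowc`∕`hupc`∕`hRegClass`∕`hlfle`∕`hlarge` at `(K, K−j)` ·
the (E)-data `Dm∕Tg` with their four side conditions · ONE transport letter per height · the (R-β1′) β slot `{prm j with β := β_K}`} — and nothing else.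

HONEST: a composition of landed doors; the transport letters are HYPOTHESES (print's one-step small-field dominance, OPEN — inputs named in UV3-NODE §69.19 (4)); nothing of
Bałaban's renormalisation-group analysis asserted or proved; (m) AS TYPED suspect-false at `L = 3` (RULING №105), (m)_E OPEN; the five registered stubs (3732b7df) ∕ 20520 ∕
19936 ∕ 19200 ∕ `YM3TorusSU2` NOT proved; rung R3 = SU(2) YM₃ on T³ — NOT d = 4, NOT infinite volume, NOT a mass gap, NOT Clay.  Sorry-free, axioms standard.
References: [Balaban1985UV3] CMP 102 (1985) (2) p.256, (7) p.257, (41) p.266, (47) p.267; [Balaban1987RG1] CMP 109 (1987) (0.11)∕(0.13) pp.253–254.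
-/

set_option autoImplicit false

noncomputable section

namespace Summit.QuantumFields.YangMills.Theorems.FluctuationComparisonRegPrIntLS1aAlphaPhiMTowerTransport

open MeasureTheory Set
open Literature.MathematicalPhysics.QuantumFieldTheory.Balaban1983to89
open T3ContinuumYM3Torus T3UnitScaleTilt T3UnitLawDensityEML T3RestrictedUnitDensity T3AlphaInputsAC T3AlphaInputsACSchemas T3AlphaInputsACTrivRows BalabanUVClass
open T3NestedUnitLaws (descend)
open T3LevelShift (fieldShift)
open T3TiltDescent (heightDensity)
open B5Eq118OneStroke (iterBlockOf)
open Literature.MathematicalPhysics.QuantumFieldTheory.Balaban1983to89.Missing (partitionFn)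
open Literature.MathematicalPhysics.QuantumFieldTheory.Balaban1983to89.T4AveragingDisintegration (kernelTransport)
open Summit.QuantumFields.YangMills.Theorems.FluctuationComparisonRegPrIntLS1aAlphaPhiMTowerBG (exists_admissible_schedule_phiM_tower_bg)
open Summit.QuantumFields.YangMills.Theorems.FluctuationComparisonRegPrIntLS1aDomBGOfOneStepLetters (sum_Ico_le_geom)
open Summit.QuantumFields.YangMills.Theorems.FluctuationComparisonRegPrIntLS1aOneStepLetterOfTransportBound (hdomBG_of_transportLetters_heightDensity)

variable {F : T3Family} {γ : ℝ}

/-- ★★★ **THE ᵀ-EDITION OF THE (m)-DOOR OF RECORD FOR THE TOWER.**  ✓p831345's statement with the cut-height letter `hdomBG_j` replaced by the supplier's (E)-domains ∕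
plateau targets and ONE TRANSPORT LETTER PER HEIGHT `i ∈ [j, Ts)` on print's renormalised densities (see the module docstring for the three edits); ONE admissible
schedule (slack enlarged by `(c∕(1−q))·q^j`); conclusion = the v1.2 letter `Φ_m` for the CUT density with the schedule entry `{prm j with β := β_K}`, byte for byte.
Nothing of Bałaban's asserted; the transport letters are HYPOTHESES. [cite: Balaban1985UV3, (41)-(47) pp.266-267, (2) p.256, (7) p.257; Balaban1987RG1, (0.13) p.254] -/
theorem exists_admissible_schedule_phiM_tower_transport {D : AlphaDataT3 F γ} (W : LFData D) {b₀ p₀ ε₀ C68 Cχ B₃ r CD R₀ C₅ : ℝ} {M₁ : ℕ}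
    (h : AlphaInputsT3ACFullTriv D W b₀ p₀ ε₀ C68 Cχ B₃ M₁ r CD) (hγ : 0 < γ) (hγ1 : γ ≤ 1) (hγe : Real.sqrt γ ≤ Real.exp (1 - p₀)) (hb : 0 ≤ b₀) (hp : 0 ≤ p₀)
    (hr : 0 ≤ r) (hM1 : 1 ≤ M₁) (hMdvd : M₁ ∣ 2 * F.L ^ F.m) (hCD : 0 ≤ CD) (hR₀ : 0 < R₀)
    (η : ℕ → ℝ) {c q : ℝ} (hq0 : 0 ≤ q) (hq1 : q < 1) (hc : 0 ≤ c) (hη : ∀ i, η i ≤ c * q ^ i) :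
    ∃ prm : ℕ → ClassParams, AdmissibleClassParams F γ (b₀ / 2) p₀ prm ∧
      (∀ n, (prm n).δ = θBal F.L γ b₀ p₀ n ∧ (prm n).δreg = R₀ ∧ (prm n).δL = θBal F.L γ b₀ p₀ n ∧ (prm n).β = (F.L : ℝ) ^ n / γ ∧
        (prm n).cLF = B10.pFun (b₀ / 2) p₀ (Real.sqrt (γ * ((F.L : ℝ)⁻¹) ^ n)) ^ 2 / 4 ∧ (prm n).c5 = C₅ ∧ (prm n).cE = 0) ∧
      ∀ (ν : ℕ → (j : ℕ) → Measure (GaugeField (F.P j) 0 (Matrix.specialUnitaryGroup (Fin 2) ℂ))),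
        (∀ K, ν K K = T4GenFunBounds.gibbsMeasure (F.P K) ((F.scheme ℰp γ).β K)) →
        (∀ K j, j < K → ν K j = Measure.map (descend F ℰp j) (ν K (j + 1))) →
        ∀ (K Ts : ℕ) (hTs : Ts ≤ K) (μ : (j : ℕ) → Measure (GaugeField (F.P j) 0 (Matrix.specialUnitaryGroup (Fin 2) ℂ)))
          (χ : (j : ℕ) → GaugeField (F.P j) 0 (Matrix.specialUnitaryGroup (Fin 2) ℂ) → ℝ), (∀ j U, χ j U ≤ 1) →
          (∀ (j : ℕ) (u : GaugeTransf (F.P j) 0 (Matrix.specialUnitaryGroup (Fin 2) ℂ)) (U : GaugeField (F.P j) 0 (Matrix.specialUnitaryGroup (Fin 2) ℂ)),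
            χ j (GaugeField.gaugeAct u U) = χ j U) →
          (∀ j, Measurable (χ j)) →
          (∀ j, Ts ≤ j → μ j = ν K j) →
          (∀ j, j < Ts → μ j = Measure.map (descend F ℰp j) ((μ (j + 1)).withDensity fun U => ENNReal.ofReal (χ (j + 1) U))) →
        ∀ (j : ℕ) (hjK : j ≤ K) (ρc ρt : GaugeField (F.P j) 0 (Matrix.specialUnitaryGroup (Fin 2) ℂ) → ℝ),
          Continuous ρc → Continuous ρt → (∀ V, 0 ≤ ρc V) → (∀ V, 0 ≤ ρt V) →
          μ j = (fieldMeasure (F.P j) 0 (Matrix.specialUnitaryGroup (Fin 2) ℂ)).withDensity (fun V => ENNReal.ofReal (ρc V)) →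
          ν K j = (fieldMeasure (F.P j) 0 (Matrix.specialUnitaryGroup (Fin 2) ℂ)).withDensity (fun V => ENNReal.ofReal (ρt V)) →
          ContinuousOn (D.low K (K - j)) {V | PlaqSmall (θBal F.L γ b₀ p₀ j) V} →
          ContinuousOn (D.up K (K - j)) {V | PlaqSmall (θBal F.L γ b₀ p₀ j) V} →
          (∀ V : GaugeField (F.P K) (K - j) (Matrix.specialUnitaryGroup (Fin 2) ℂ), PlaqSmall (θBal F.L γ b₀ p₀ j) V →
            IsBackground (fun i => BlockAveraging.blockAvg (P := F.P K) (j := i) ℰp) {U | PlaqSmall R₀ U} (K - j) V (D.Umin K (K - j) (D.triv K (K - j)) V)) →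
          (∀ V : GaugeField (F.P K) (K - j) (Matrix.specialUnitaryGroup (Fin 2) ℂ),
            Real.exp (D.Ecst K (K - j)) * (Real.exp (-(D.Ecst K (K - j)) + D.Rm K (K - j)) * (D.up K (K - j) V - D.low K (K - j) V)) ≤
              Real.exp (-(prm j).cLF) * Real.exp (C₅ * Fintype.card (Site (F.P K) (K - j)))) →
          (∀ (V : GaugeField (F.P K) (K - j) (Matrix.specialUnitaryGroup (Fin 2) ℂ)) (S : Finset (Plaq (F.P K) (K - j))),
            (∀ p ∈ S, θBal F.L γ b₀ p₀ j ≤ GaugeGroup.dist1 (GaugeField.plaqHol V p)) →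
              Real.exp (D.Ecst K (K - j)) * (partitionFn (G := (Matrix.specialUnitaryGroup (Fin 2) ℂ)) (F.P K) ((F.scheme ℰp γ).β K) * readAtLevel F hjK ρt V) ≤
                Real.exp (-((prm j).cLF * S.card)) * Real.exp (C₅ * Fintype.card (Site (F.P K) (K - j)))) →
          -- the supplier's (E)-DOMAINS and plateau TARGETS per height, and the TRANSPORT LETTERS for the heights `j ≤ i < Ts` (replacing `hdomBG_j`)
          ∀ (Dm Tg : (i : ℕ) → Set (GaugeField (F.P i) 0 (Matrix.specialUnitaryGroup (Fin 2) ℂ))),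
          (∀ i, MeasurableSet (Tg i)) → (∀ i, Tg i ⊆ Dm i) → IsOpen (Dm j) →
          (∀ (i : ℕ), j < i → i ≤ Ts → ∀ U ∈ Tg i, χ i U = 1) →
          (∀ V : GaugeField (F.P K) (K - j) (Matrix.specialUnitaryGroup (Fin 2) ℂ), PlaqSmall (θBal F.L γ b₀ p₀ j) V →
            (∃ U₀ : GaugeField (F.P K) 0 (Matrix.specialUnitaryGroup (Fin 2) ℂ),
                IsBackground (fun i => BlockAveraging.blockAvg (P := F.P K) (j := i) ℰp) {U | PlaqSmall R₀ U} (K - j) V U₀ ∧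
                PlaqSmall (θBal F.L γ b₀ p₀ j * ((F.L : ℝ)⁻¹) ^ (2 * (K - j))) U₀) →
            fieldShift (heightShift_eq F hjK) V ∈ Dm j) →
          (∀ (i : ℕ), j ≤ i → ∀ (hiT : i < Ts), ∀ᵐ V ∂(fieldMeasure (F.P i) 0 (Matrix.specialUnitaryGroup (Fin 2) ℂ)), V ∈ Dm i →
            kernelTransport (fieldMeasure (F.P (i + 1)) 0 (Matrix.specialUnitaryGroup (Fin 2) ℂ)) (fieldMeasure (F.P i) 0 (Matrix.specialUnitaryGroup (Fin 2) ℂ))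
                (descend F ℰp i) (heightDensity F γ (Nat.succ_le_of_lt (lt_of_lt_of_le hiT hTs)) Set.univ) V ≤
              Real.exp (η i) * kernelTransport (fieldMeasure (F.P (i + 1)) 0 (Matrix.specialUnitaryGroup (Fin 2) ℂ))
                (fieldMeasure (F.P i) 0 (Matrix.specialUnitaryGroup (Fin 2) ℂ)) (descend F ℰp i)
                ((Tg (i + 1)).indicator (heightDensity F γ (Nat.succ_le_of_lt (lt_of_lt_of_le hiT hTs)) Set.univ)) V) →
          ∃ κ : ℝ, ∃ (bg : GaugeField (F.P K) (K - j) (Matrix.specialUnitaryGroup (Fin 2) ℂ) → GaugeField (F.P K) 0 (Matrix.specialUnitaryGroup (Fin 2) ℂ))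
            (nDom : ℕ) (supp : Fin nDom → Set (PBond (F.P K) 0)) (foot : Fin nDom → Finset (Site (F.P K) (K - j)))
            (len : Fin nDom → ℝ) (wt : Fin nDom → ℝ) (act : Fin nDom → GaugeField (F.P K) 0 (Matrix.specialUnitaryGroup (Fin 2) ℂ) → ℝ)
            (cst : ℝ) (lf : GaugeField (F.P K) (K - j) (Matrix.specialUnitaryGroup (Fin 2) ℂ) → ℝ),
            (∀ V, 0 ≤ readAtLevel F hjK (fun U => Real.exp κ * ρc U) V) ∧
            Measurable (readAtLevel F hjK (fun U => Real.exp κ * ρc U)) ∧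
            GaugeField.GaugeInvariant (readAtLevel F hjK (fun U => Real.exp κ * ρc U)) ∧
            (∀ V, PlaqSmall ({ prm j with β := (F.scheme ℰp γ).β K }).δ V →
              IsBackground (fun i => BlockAveraging.blockAvg (P := F.P K) (j := i) ℰp) {U | PlaqSmall ({ prm j with β := (F.scheme ℰp γ).β K }).δreg U} (K - j) V (bg V)) ∧
            (∀ X, (foot X).Nonempty) ∧ (∀ X b, b ∈ supp X → iterBlockOf (K - j) b.src ∈ foot X) ∧ (∀ X, 0 ≤ len X) ∧ (∀ X, 0 ≤ wt X) ∧
            (∀ X, ∀ y ∈ foot X, ∀ y' ∈ foot X, (Site.tdist y y' : ℝ) ≤ ({ prm j with β := (F.scheme ℰp γ).β K }).M * (len X + 1)) ∧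
            (∀ X (U U' : GaugeField (F.P K) 0 (Matrix.specialUnitaryGroup (Fin 2) ℂ)), (∀ b ∈ supp X, U b = U' b) → act X U = act X U') ∧
            (∀ X, GaugeField.GaugeInvariant (act X)) ∧
            (∀ X V, PlaqSmall ({ prm j with β := (F.scheme ℰp γ).β K }).δ V → PlaqSmall (({ prm j with β := (F.scheme ℰp γ).β K }).δ * ((F.L : ℝ)⁻¹) ^ (2 * (K - j))) (bg V) →
              |act X (bg V)| ≤ wt X * Real.exp (-(({ prm j with β := (F.scheme ℰp γ).β K }).κ * len X))) ∧
            (∀ y : Site (F.P K) (K - j), ∑ X ∈ Finset.univ.filter (fun X => y ∈ foot X), wt X * Real.exp (-(({ prm j with β := (F.scheme ℰp γ).β K }).κ * len X)) ≤ ({ prm j with β := (F.scheme ℰp γ).β K }).Ccov) ∧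
            |cst| ≤ ({ prm j with β := (F.scheme ℰp γ).β K }).cE * Fintype.card (Site (F.P K) (K - j)) ∧
            (∀ V, PlaqSmall ({ prm j with β := (F.scheme ℰp γ).β K }).δ V → PlaqSmall (({ prm j with β := (F.scheme ℰp γ).β K }).δ * ((F.L : ℝ)⁻¹) ^ (2 * (K - j))) (bg V) →
              Real.exp (-(({ prm j with β := (F.scheme ℰp γ).β K }).β * wilsonAction4 (bg V)) + (∑ X, act X (bg V)) + cst - ({ prm j with β := (F.scheme ℰp γ).β K }).slack) ≤ readAtLevel F hjK (fun U => Real.exp κ * ρc U) V) ∧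
            (∀ V, PlaqSmall ({ prm j with β := (F.scheme ℰp γ).β K }).δ V → PlaqSmall (({ prm j with β := (F.scheme ℰp γ).β K }).δ * ((F.L : ℝ)⁻¹) ^ (2 * (K - j))) (bg V) →
              readAtLevel F hjK (fun U => Real.exp κ * ρc U) V ≤ Real.exp (-(({ prm j with β := (F.scheme ℰp γ).β K }).β * wilsonAction4 (bg V)) + (∑ X, act X (bg V)) + cst + ({ prm j with β := (F.scheme ℰp γ).β K }).slack) + lf V) ∧
            (∀ V, 0 ≤ lf V) ∧ (∀ V, lf V ≤ Real.exp (-({ prm j with β := (F.scheme ℰp γ).β K }).cLF) * Real.exp (({ prm j with β := (F.scheme ℰp γ).β K }).c5 * Fintype.card (Site (F.P K) (K - j)))) ∧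
            (∀ V (S : Finset (Plaq (F.P K) (K - j))), (∀ p ∈ S, ({ prm j with β := (F.scheme ℰp γ).β K }).δL ≤ dist1 (GaugeField.plaqHol V p)) →
              readAtLevel F hjK (fun U => Real.exp κ * ρc U) V ≤ Real.exp (-(({ prm j with β := (F.scheme ℰp γ).β K }).cLF * S.card)) * Real.exp (({ prm j with β := (F.scheme ℰp γ).β K }).c5 * Fintype.card (Site (F.P K) (K - j)))) := by
  obtain ⟨prm, hadm, hfields, hmain⟩ := exists_admissible_schedule_phiM_tower_bg (F := F) W h hγ hγ1 hγe hb hp hr hM1 hMdvd hCD hR₀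
    (fun j => c / (1 - q) * q ^ j) hq0 hq1 (fun j => mul_nonneg (div_nonneg hc (by linarith)) (pow_nonneg hq0 j)) (fun j => le_rfl)
  refine ⟨prm, hadm, hfields, ?_⟩
  intro ν hν1 hν2 K Ts hTs μ χ hχ1 hχinv hχm hμ1 hμ2 j hjK ρc ρt hcc htc hc0 ht0 hμc hνt hlowc hupc hRegClass hlfle hlarge Dm Tg hTm hTD hDo hplat hgood hKL
  exact hmain ν hν1 hν2 K Ts hTs μ χ hχ1 hχinv hμ1 hμ2 j hjK ρc ρt hcc htc hc0 ht0 hμc hνt hlowc hupc hRegClass hlfle hlarge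
    (hdomBG_of_transportLetters_heightDensity F ν μ χ Dm Tg hγ.le hν1 hν2 hTs hχm hμ1 hμ2 hTm hTD η hjK hplat hKL hDo
      (sum_Ico_le_geom hq0 hq1 hc hη j Ts) ρc ρt hcc htc hc0 hμc hνt hgood)

end Summit.QuantumFields.YangMills.Theorems.FluctuationComparisonRegPrIntLS1aAlphaPhiMTowerTransport

end
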